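import Mathlib

/-!
# Conjecture N (hodge-weil ladder, GAPS G51b), format (5,3): AGGREGATE IDENTITIES FOR AN ARBITRARY CONFIGURATION

Prover 2, generation 23 (note `run/shared/lean/b2b/hodge-weil/b2b-hweil-pv2-g23/CROSSPLUS2-G23.md`). Corner coordinates about a base point `(As, us)` as in
generations 21/22: E-roots `(As + x_k + y_k, us + x_k − y_k)`, F-roots `(As − p_g − q_g, us + q_g − p_g)`, NO root assumed on the cross. Aggregates over ALL roots:
`X = Σx + Σp`, `M = Σy + Σq`, `D⁺ = Σx² − Σp²`, `D⁻ = Σy² − Σq²`, unsigned cubic corner sums `C₃⁺ = Σx³ + Σp³`, `C₃⁻ = Σy³ + Σq³`, and the defect sums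
`E = Σ x_ky_k − Σ p_gq_g`, `Φ₀ = Σ x_ky_k(x_k − y_k) − Σ p_gq_g(q_g − p_g)`, `Σ₁ = Σ x_ky_k(x_k + y_k) + Σ p_gq_g(p_g + q_g)` (all vanish for on-cross roots).
With the centring relations `2us = M − X`, `2As = −(X + M)`:
* `S_general` : `Σεu² = D⁺ + D⁻ − (X−M)²/2 − 2E`;
* `P4_general` : `Σεu³ = 2us³ + 3us²(X−M) + 3us(D⁺+D⁻−2E) + C₃⁺ − C₃⁻ − 3Φ₀`;
* `P2_general` : `ΣεA·u² = As·S + us²(X+M) + 2us(D⁺−D⁻) + C₃⁺ + C₃⁻ − Σ₁`;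
* `K_general`  : `P4 − P1 = 2M·D⁺ − 2X·D⁻ + 4XM·us − 8us·E − 4Φ₀` (`P1 = ΣεA²u`).
These are the symbols of `WeilClassTestFormatFiveThreePurityLineForm` (any number of free roots) evaluated on a configuration; generation 22's
`S/P2/P4/K_on_cross_plus_one(_F)` are the cases with seven defects zero. Pure `ring`; nothing here is a case of HC, a rung or a door edge; no statement of
Markman's papers is used; COUNT of record unchanged. New cell result ⇒ Summits/.
-/

set_option linter.dupNamespace false
set_option maxRecDepth 16384

namespace Summit.HodgeConjecture.HodgeConjecture.WeilClassTestFormatFiveThreeGeneralAggregates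

set_option maxHeartbeats 4000000 in
/-- `S = Σεu²` for an arbitrary configuration: `S = D⁺ + D⁻ − (X−M)²/2 − 2E`. -/
theorem S_general (x₁ x₂ x₃ x₄ x₅ y₁ y₂ y₃ y₄ y₅ p₁ p₂ p₃ q₁ q₂ q₃ us : ℝ) (hus : 2 * us = (y₁ + y₂ + y₃ + y₄ + y₅ + q₁ + q₂ + q₃) - (x₁ + x₂ + x₃ + x₄ + x₅ + p₁ + p₂ + p₃)) :
    (((us + x₁ - y₁) ^ 2 + (us + x₂ - y₂) ^ 2 + (us + x₃ - y₃) ^ 2 + (us + x₄ - y₄) ^ 2 + (us + x₅ - y₅) ^ 2) - ((us + q₁ - p₁) ^ 2 + (us + q₂ - p₂) ^ 2 + (us + q₃ - p₃) ^ 2))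
      = (((x₁ ^ 2 + x₂ ^ 2 + x₃ ^ 2 + x₄ ^ 2 + x₅ ^ 2) - (p₁ ^ 2 + p₂ ^ 2 + p₃ ^ 2)) + ((y₁ ^ 2 + y₂ ^ 2 + y₃ ^ 2 + y₄ ^ 2 + y₅ ^ 2) - (q₁ ^ 2 + q₂ ^ 2 + q₃ ^ 2)) - ((x₁ + x₂ + x₃ + x₄ + x₅ + p₁ + p₂ + p₃) - (y₁ + y₂ + y₃ + y₄ + y₅ + q₁ + q₂ + q₃)) ^ 2 / 2 - 2 * ((x₁ * y₁ + x₂ * y₂ + x₃ * y₃ + x₄ * y₄ + x₅ * y₅) - (p₁ * q₁ + p₂ * q₂ + p₃ * q₃))) := by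
  have hus' : us = ((y₁ + y₂ + y₃ + y₄ + y₅ + q₁ + q₂ + q₃) - (x₁ + x₂ + x₃ + x₄ + x₅ + p₁ + p₂ + p₃)) / 2 := by linarith
  subst hus'
  ring

set_option maxHeartbeats 4000000 in
/-- `P4 = Σεu³` for an arbitrary configuration in the aggregates and the defect sum `Φ₀` (pure identity; `Σε = 2` gives the `2us³`). -/
theorem P4_general (x₁ x₂ x₃ x₄ x₅ y₁ y₂ y₃ y₄ y₅ p₁ p₂ p₃ q₁ q₂ q₃ us : ℝ)  :
    (((us + x₁ - y₁) ^ 3 + (us + x₂ - y₂) ^ 3 + (us + x₃ - y₃) ^ 3 + (us + x₄ - y₄) ^ 3 + (us + x₅ - y₅) ^ 3) - ((us + q₁ - p₁) ^ 3 + (us + q₂ - p₂) ^ 3 + (us + q₃ - p₃) ^ 3))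
      = 2 * us ^ 3 + 3 * us ^ 2 * ((x₁ + x₂ + x₃ + x₄ + x₅ + p₁ + p₂ + p₃) - (y₁ + y₂ + y₃ + y₄ + y₅ + q₁ + q₂ + q₃)) + 3 * us * (((x₁ ^ 2 + x₂ ^ 2 + x₃ ^ 2 + x₄ ^ 2 + x₅ ^ 2) - (p₁ ^ 2 + p₂ ^ 2 + p₃ ^ 2)) + ((y₁ ^ 2 + y₂ ^ 2 + y₃ ^ 2 + y₄ ^ 2 + y₅ ^ 2) - (q₁ ^ 2 + q₂ ^ 2 + q₃ ^ 2)) - 2 * ((x₁ * y₁ + x₂ * y₂ + x₃ * y₃ + x₄ * y₄ + x₅ * y₅) - (p₁ * q₁ + p₂ * q₂ + p₃ * q₃))) + ((x₁ ^ 3 + x₂ ^ 3 + x₃ ^ 3 + x₄ ^ 3 + x₅ ^ 3) + (p₁ ^ 3 + p₂ ^ 3 + p₃ ^ 3)) - ((y₁ ^ 3 + y₂ ^ 3 + y₃ ^ 3 + y₄ ^ 3 + y₅ ^ 3) + (q₁ ^ 3 + q₂ ^ 3 + q₃ ^ 3)) - 3 * ((x₁ * y₁ * (x₁ - y₁) +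 x₂ * y₂ * (x₂ - y₂) + x₃ * y₃ * (x₃ - y₃) + x₄ * y₄ * (x₄ - y₄) + x₅ * y₅ * (x₅ - y₅)) - (p₁ * q₁ * (q₁ - p₁) + p₂ * q₂ * (q₂ - p₂) + p₃ * q₃ * (q₃ - p₃))) := by
  ring

set_option maxHeartbeats 4000000 in
/-- `P2 = ΣεA·u²` for an arbitrary configuration: `As·S + us²·T + 2us(D⁺ − D⁻) + C₃⁺ + C₃⁻ − Σ₁` (`S` in aggregate form, `T = X + M`). -/
theorem P2_general (x₁ x₂ x₃ x₄ x₅ y₁ y₂ y₃ y₄ y₅ p₁ p₂ p₃ q₁ q₂ q₃ us As : ℝ) (hus : 2 * us = (y₁ + y₂ + y₃ + y₄ + y₅ + q₁ + q₂ + q₃) - (x₁ + x₂ + x₃ + x₄ + x₅ + p₁ + p₂ + p₃)) :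
    (((As + x₁ + y₁) * (us + x₁ - y₁) ^ 2 + (As + x₂ + y₂) * (us + x₂ - y₂) ^ 2 + (As + x₃ + y₃) * (us + x₃ - y₃) ^ 2 + (As + x₄ + y₄) * (us + x₄ - y₄) ^ 2 + (As + x₅ + y₅) * (us + x₅ - y₅) ^ 2) - ((As - p₁ - q₁) * (us + q₁ - p₁) ^ 2 + (As - p₂ - q₂) * (us + q₂ - p₂) ^ 2 + (As - p₃ - q₃) * (us + q₃ - p₃) ^ 2))
      = As * (((x₁ ^ 2 + x₂ ^ 2 + x₃ ^ 2 + x₄ ^ 2 + x₅ ^ 2) - (p₁ ^ 2 + p₂ ^ 2 + p₃ ^ 2)) + ((y₁ ^ 2 + y₂ ^ 2 + y₃ ^ 2 + y₄ ^ 2 + y₅ ^ 2) - (q₁ ^ 2 + q₂ ^ 2 + q₃ ^ 2)) - ((x₁ + x₂ + x₃ + x₄ + x₅ + p₁ + p₂ + p₃) - (y₁ + y₂ + y₃ + y₄ + y₅ + q₁ + q₂ + q₃)) ^ 2 / 2 - 2 * ((x₁ * y₁ + x₂ * y₂ + x₃ * y₃ + x₄ * y₄ + x₅ * y₅) - (p₁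 * q₁ + p₂ * q₂ + p₃ * q₃))) + us ^ 2 * ((x₁ + x₂ + x₃ + x₄ + x₅ + p₁ + p₂ + p₃) + (y₁ + y₂ + y₃ + y₄ + y₅ + q₁ + q₂ + q₃)) + 2 * us * (((x₁ ^ 2 + x₂ ^ 2 + x₃ ^ 2 + x₄ ^ 2 + x₅ ^ 2) - (p₁ ^ 2 + p₂ ^ 2 + p₃ ^ 2)) - ((y₁ ^ 2 + y₂ ^ 2 + y₃ ^ 2 + y₄ ^ 2 + y₅ ^ 2) - (q₁ ^ 2 + q₂ ^ 2 + q₃ ^ 2))) + ((x₁ ^ 3 + x₂ ^ 3 + x₃ ^ 3 + x₄ ^ 3 + x₅ ^ 3) + (p₁ ^ 3 + p₂ ^ 3 + p₃ ^ 3)) + ((y₁ ^ 3 + y₂ ^ 3 + y₃ ^ 3 + y₄ ^ 3 + y₅ ^ 3) + (q₁ ^ 3 + q₂ ^ 3 + q₃ ^ 3)) - ((x₁ * y₁ * (x₁ + y₁) + x₂ * y₂ * (x₂ + y₂) + x₃ * y₃ * (x₃ + y₃) + x₄ * y₄ * (x₄ + y₄) + x₅ * y₅ * (x₅ + y₅))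 + (p₁ * q₁ * (p₁ + q₁) + p₂ * q₂ * (p₂ + q₂) + p₃ * q₃ * (p₃ + q₃))) := by
  have hus' : us = ((y₁ + y₂ + y₃ + y₄ + y₅ + q₁ + q₂ + q₃) - (x₁ + x₂ + x₃ + x₄ + x₅ + p₁ + p₂ + p₃)) / 2 := by linarith
  subst hus'
  ring

set_option maxHeartbeats 4000000 in
/-- `K = P4 − P1` (`P1 = ΣεA²u`) for an arbitrary configuration is free of the cubic sums: `2M·D⁺ − 2X·D⁻ + 4XM·us − 8us·E − 4Φ₀`. -/
theorem K_general (x₁ x₂ x₃ x₄ x₅ y₁ y₂ y₃ y₄ y₅ p₁ p₂ p₃ q₁ q₂ q₃ us As : ℝ) (hus : 2 * us = (y₁ + y₂ + y₃ + y₄ + y₅ + q₁ + q₂ + q₃) - (x₁ + x₂ + x₃ + x₄ + x₅ + p₁ + p₂ + p₃)) (hAs : 2 * As = -((x₁ + x₂ + x₃ + x₄ + x₅ + p₁ + p₂ + p₃) + (y₁ + y₂ + y₃ + y₄ + y₅ + q₁ + q₂ + q₃))) :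
    (((us + x₁ - y₁) ^ 3 + (us + x₂ - y₂) ^ 3 + (us + x₃ - y₃) ^ 3 + (us + x₄ - y₄) ^ 3 + (us + x₅ - y₅) ^ 3) - ((us + q₁ - p₁) ^ 3 + (us + q₂ - p₂) ^ 3 + (us + q₃ - p₃) ^ 3)) - (((As + x₁ + y₁) ^ 2 * (us + x₁ - y₁) + (As + x₂ + y₂) ^ 2 * (us + x₂ - y₂) + (As + x₃ + y₃) ^ 2 * (us + x₃ - y₃) + (As + x₄ + y₄) ^ 2 * (us + x₄ - y₄) + (As + x₅ + y₅) ^ 2 * (us + x₅ - y₅)) - ((As - p₁ - q₁) ^ 2 * (us + q₁ - p₁) + (As - p₂ - q₂) ^ 2 * (us + q₂ - p₂) + (As - p₃ - q₃) ^ 2 * (us + q₃ - p₃)))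
      = 2 * (y₁ + y₂ + y₃ + y₄ + y₅ + q₁ + q₂ + q₃) * ((x₁ ^ 2 + x₂ ^ 2 + x₃ ^ 2 + x₄ ^ 2 + x₅ ^ 2) - (p₁ ^ 2 + p₂ ^ 2 + p₃ ^ 2)) - 2 * (x₁ + x₂ + x₃ + x₄ + x₅ + p₁ + p₂ + p₃) * ((y₁ ^ 2 + y₂ ^ 2 + y₃ ^ 2 + y₄ ^ 2 + y₅ ^ 2) - (q₁ ^ 2 + q₂ ^ 2 + q₃ ^ 2)) + 4 * (x₁ + x₂ + x₃ + x₄ + x₅ + p₁ + p₂ + p₃) * (y₁ + y₂ + y₃ + y₄ + y₅ + q₁ + q₂ + q₃) * us - 8 * us * ((x₁ * y₁ + x₂ * y₂ + x₃ * y₃ + x₄ * y₄ + x₅ * y₅) - (p₁ * q₁ + p₂ * q₂ + p₃ * q₃)) - 4 * ((x₁ * y₁ * (x₁ - y₁) + x₂ * y₂ * (x₂ - y₂) + x₃ * y₃ * (x₃ - y₃) + x₄ * y₄ * (x₄ - y₄) + x₅ * y₅ * (x₅ - y₅)) - (p₁ * q₁ * (q₁ - p₁) + p₂ * q₂ * (q₂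 - p₂) + p₃ * q₃ * (q₃ - p₃))) := by
  have hus' : us = ((y₁ + y₂ + y₃ + y₄ + y₅ + q₁ + q₂ + q₃) - (x₁ + x₂ + x₃ + x₄ + x₅ + p₁ + p₂ + p₃)) / 2 := by linarith
  have hAs' : As = -((x₁ + x₂ + x₃ + x₄ + x₅ + p₁ + p₂ + p₃) + (y₁ + y₂ + y₃ + y₄ + y₅ + q₁ + q₂ + q₃)) / 2 := by linarith
  subst hus' hAs'
  ring

end Summit.HodgeConjecture.HodgeConjecture.WeilClassTestFormatFiveThreeGeneralAggregates
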